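import Summits.ValiantsHypothesis.ValiantsHypothesis.Theorems.BarrierLeverSigmaPiSigmaSliceEquations
import Literature.Computability.AlgebraicComplexity.FSV18SuccinctGenerators

/-!
# Route BarrierLever — the MODEL axis of crux `DefinableEquations` (stmt-ValiantsHypothesis-8745) /
# item `SingleSizeEquations` (8749): the `∃ a ∀ b` natural proof against READ-ONCE OBLIVIOUS ABPs
# (every polynomial width, every variable order) — part 1/2: Nisan's rank bound and the certificate

The crux asks for ONE level `a` such that for EVERY size exponent `b`, eventually in `n`, a nonzero
level-`a` distinguisher in the `N = C(2n,n)` coefficient variables vanishes on the coefficient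
vectors of `SmallCircuits ℂ n b` (open).  After the depth-3 slices (`…SigmaLambdaSigmaSlice*`,
`…SigmaPiSigmaSlice*`) this file and its sequel prove that sentence, with the same quantifier order,
for the class `roabpSlice n (n^b)` of degree-`≤ n` polynomials computed by a read-once oblivious
algebraic branching program (the tree's `IsROABP`, Forbes–Shpilka–Volk 2018 §5.3: ordered product of
`w × w` matrices of univariate polynomials) of width `n^b` in SOME variable order — Nisan's (1991)
rank method, the third classical rank-type lower bound, made FSV-natural at `poly(N)` cost.

* Nisan's bound (`row_mem_span_of_isROABP`): if `f` has a width-`w` ROABP in the order `π`, then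
  `f = Σ_{r<w} P_{0r} Q_{r0}` with `P` a polynomial in the first `⌊n/2⌋` variables of the order and
  `Q` in the others (`apply_prod_mem`: entries of an ordered product of layer matrices lie in the
  subalgebra `supported ℂ A`), so the coefficient matrix across the cut
  `A_π = π{0,…,⌊n/2⌋-1}` (`coeff_add_mul_of_supported`: `coeff_{α+β}(PQ) = coeff_α P · coeff_β Q`
  for `α` supported in `A`, `β` in `Aᶜ`) has its rows in the span of `w` vectors.
* Certificate (`nisanCert n`): the PRODUCT over all balanced cuts `A` (`|A| = ⌊n/2⌋`, at most `2^n`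
  of them) of the determinant of the `2^{⌊n/2⌋} × 2^{⌊n/2⌋}` matrix of coefficient VARIABLES
  `c_{x^{ρ_A U} x^{κ_A U'}}` (`U, U' ⊆ Fin ⌊n/2⌋` embedded into `A` resp. its complement by
  `rowEmb`/`colEmb`).  VANISHING (`eval_nisanCert_eq_zero_of_isROABP`): the factor of `A_π` vanishes
  as soon as `w < 2^{⌊n/2⌋}`.
Part 2 (`…ROABPSliceEquations`): non-vanishing (a product of nonzero determinants in a domain),
constructivity (level 20), thresholds and the headline `naturalProofsAgainstROABP`.
WHAT THIS IS NOT: nothing on general circuits / ABPs (the crux, CT23 dir. 2), 8746, 14610 or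
VP vs VNP; classical (Nisan 1991) mathematics made FSV-natural and kernel-checked.
-/

-- layout Summits/ValiantsHypothesis/ValiantsHypothesis forces the duplicated namespace component
set_option linter.dupNamespace false

noncomputable section

open MvPolynomial Finsupp

namespace Summit.ValiantsHypothesis.ValiantsHypothesis.Theorems.BarrierLever.ROABPSlice

open Literature.Computability.AlgebraicComplexity Literature.Barriers.ValiantsHypothesis
open SigmaLambdaSigmaSlice (det_eq_zero_of_rows_mem_submodule degree_sqfree)

/-! ## Generalities: variable supports, coefficient separation, ordered matrix products -/

section general

variable {n : ℕ}

/-- A monomial of a polynomial supported in the variable set `A` is supported in `A`. [folklore] -/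
theorem support_subset_of_mem_supported {A : Set (Fin n)} {g : MvPolynomial (Fin n) ℂ}
    (hg : g ∈ supported ℂ A) {γ : Fin n →₀ ℕ} (hγ : γ ∈ g.support) : ↑γ.support ⊆ A := by
  intro v hv
  exact mem_supported.mp hg ((mem_vars_iff_mem_support v).mpr ⟨γ, hγ, hv⟩)

/-- **Coefficient separation across a cut**: if `g` only involves variables in `A`, `h` only
variables outside `A`, and the exponents `α`, `β` are supported in `A` resp. outside `A`, then
`coeff_{α+β}(g h) = coeff_α(g) · coeff_β(h)`. [cite: Nisan1991Noncommutative, Lemma 1 (proof)] -/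
theorem coeff_add_mul_of_supported {A : Set (Fin n)} {g h : MvPolynomial (Fin n) ℂ}
    (hg : g ∈ supported ℂ A) (hh : h ∈ supported ℂ Aᶜ) {α β : Fin n →₀ ℕ}
    (hα : ↑α.support ⊆ A) (hβ : ↑β.support ⊆ Aᶜ) :
    coeff (α + β) (g * h) = coeff α g * coeff β h := by
  classical
  rw [coeff_mul, Finset.sum_eq_single (α, β)]
  · rintro ⟨γ, δ⟩ hmem hne
    by_contra hprod
    have hγ0 : coeff γ g ≠ 0 := left_ne_zero_of_mul hprod
    have hδ0 : coeff δ h ≠ 0 := right_ne_zero_of_mul hprod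
    have hγA := support_subset_of_mem_supported hg (MvPolynomial.mem_support_iff.mpr hγ0)
    have hδA := support_subset_of_mem_supported hh (MvPolynomial.mem_support_iff.mpr hδ0)
    have hsum : γ + δ = α + β := Finset.HasAntidiagonal.mem_antidiagonal.mp hmem
    have hγα : γ = α := by
      ext v
      have hv := DFunLike.congr_fun hsum v
      simp only [Finsupp.add_apply] at hv
      by_cases hvA : v ∈ A
      · have h1 : δ v = 0 := by
          by_contra h1; exact hδA (Finsupp.mem_support_iff.mpr h1) hvA
        have h2 : β v = 0 := by
          by_contra h2; exact hβ (Finsupp.mem_support_iff.mpr h2) hvA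
        omega
      · have h1 : γ v = 0 := by
          by_contra h1; exact hvA (hγA (Finsupp.mem_support_iff.mpr h1))
        have h2 : α v = 0 := by
          by_contra h2; exact hvA (hα (Finsupp.mem_support_iff.mpr h2))
        omega
    apply hne
    rw [hγα] at hsum ⊢
    rw [add_right_inj] at hsum
    rw [hsum]
  · intro hmem
    exfalso
    exact hmem (Finset.HasAntidiagonal.mem_antidiagonal.mpr rfl)

/-- Entries of an ordered product of matrices with entries in a subalgebra lie in that subalgebra.
[folklore] -/
theorem apply_prod_mem {w : ℕ} (S : Subalgebra ℂ (MvPolynomial (Fin n) ℂ)) :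
    ∀ (L : List (Matrix (Fin w) (Fin w) (MvPolynomial (Fin n) ℂ))),
      (∀ M ∈ L, ∀ a b, M a b ∈ S) → ∀ a b, L.prod a b ∈ S
  | [], _, a, b => by
    rw [List.prod_nil, Matrix.one_apply]
    split_ifs
    · exact S.one_mem
    · exact S.zero_mem
  | M :: L, hL, a, b => by
    rw [List.prod_cons, Matrix.mul_apply]
    exact S.sum_mem fun c _ => S.mul_mem (hL M List.mem_cons_self a c)
      (apply_prod_mem S L (fun M' hM' => hL M' (List.mem_cons_of_mem M hM')) c b)

/-- A univariate polynomial in `x_v` is supported in any variable set containing `v`. [folklore] -/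
theorem aeval_X_mem_supported {A : Set (Fin n)} {v : Fin n} (hv : v ∈ A) (p : Polynomial ℂ) :
    Polynomial.aeval (X v : MvPolynomial (Fin n) ℂ) p ∈ supported ℂ A := by
  rw [supported_eq_adjoin_X]
  exact Algebra.adjoin_mono (Set.singleton_subset_iff.mpr (Set.mem_image_of_mem X hv))
    (Polynomial.aeval_mem_adjoin_singleton ℂ _)

end general

/-! ## Balanced cuts, the slice, and the certificate -/

section slice

variable (n : ℕ)

/-- **The ROABP slice**: degree-`≤ n` polynomials in `x_0,…,x_{n-1}` computed by a read-once
oblivious ABP of width `w` (individual degree `≤ n`) in SOME variable order `π`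
(the tree's `IsROABP`). [cite: ForbesShpilkaVolk2018, §5.3] -/
def roabpSlice (w : ℕ) : Set (MvPolynomial (Fin n) ℂ) :=
  {f | f.totalDegree ≤ n ∧ ∃ π : Fin n ≃ Fin n, IsROABP ℂ w n π f}

/-- The index type of the balanced cuts: `⌊n/2⌋`-subsets `A` of the variables. [folklore] -/
abbrev Cut : Type := {A : Finset (Fin n) // A.card = n / 2}

/-- The row/column index type of each cut matrix: subsets of `Fin ⌊n/2⌋`. [folklore] -/
abbrev HSub : Type := Finset (Fin (n / 2))

variable {n}

/-- The complement of a balanced cut has at least `⌊n/2⌋` elements. [folklore] -/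
theorem half_le_card_compl (A : Cut n) : n / 2 ≤ (Finset.univ \ A.1).card := by
  rw [Finset.card_sdiff_of_subset (Finset.subset_univ _), Finset.card_univ, Fintype.card_fin, A.2]
  omega

/-- The order-preserving enumeration `ρ_A : Fin ⌊n/2⌋ ↪ A` of a balanced cut. [folklore] -/
def rowEmb (A : Cut n) : Fin (n / 2) ↪ Fin n := (A.1.orderEmbOfFin A.2).toEmbedding

/-- An enumeration `κ_A : Fin ⌊n/2⌋ ↪ Aᶜ` of the first `⌊n/2⌋` elements outside the cut. [folklore] -/
def colEmb (A : Cut n) : Fin (n / 2) ↪ Fin n :=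
  (Fin.castLEEmb (half_le_card_compl A)).trans
    ((Finset.univ \ A.1).orderEmbOfFin rfl).toEmbedding

/-- `ρ_A` lands in `A`. [folklore] -/
theorem rowEmb_mem (A : Cut n) (j : Fin (n / 2)) : rowEmb A j ∈ A.1 :=
  Finset.orderEmbOfFin_mem A.1 A.2 j

/-- `κ_A` lands outside `A`. [folklore] -/
theorem colEmb_not_mem (A : Cut n) (j : Fin (n / 2)) : colEmb A j ∉ A.1 := by
  have h := Finset.orderEmbOfFin_mem (Finset.univ \ A.1) rfl
    (Fin.castLE (half_le_card_compl A) j)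
  rw [Finset.mem_sdiff] at h
  exact h.2

/-- The row exponent `x^{ρ_A U}` is supported in `A`. [folklore] -/
theorem support_sqfree_map_rowEmb (A : Cut n) (U : HSub n) :
    ↑(sqfree (U.map (rowEmb A))).support ⊆ (↑A.1 : Set (Fin n)) := by
  classical
  intro v hv
  rw [Finset.mem_coe, Finsupp.mem_support_iff, sqfree_apply] at hv
  split_ifs at hv with h
  · obtain ⟨j, -, rfl⟩ := Finset.mem_map.mp h
    exact rowEmb_mem A j
  · exact absurd rfl hv

/-- The column exponent `x^{κ_A U'}` is supported outside `A`. [folklore] -/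
theorem support_sqfree_map_colEmb (A : Cut n) (U : HSub n) :
    ↑(sqfree (U.map (colEmb A))).support ⊆ (↑A.1 : Set (Fin n))ᶜ := by
  classical
  intro v hv
  rw [Finset.mem_coe, Finsupp.mem_support_iff, sqfree_apply] at hv
  split_ifs at hv with h
  · obtain ⟨j, -, rfl⟩ := Finset.mem_map.mp h
    exact fun hmem => colEmb_not_mem A j hmem
  · exact absurd rfl hv

/-- `deg (x^{ρ_A U} x^{κ_A U'}) ≤ n`. [folklore] -/
theorem degree_cutExp_le (A : Cut n) (U U' : HSub n) :
    (sqfree (U'.map (colEmb A)) + sqfree (U.map (rowEmb A))).degree ≤ n := by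
  classical
  rw [map_add, degree_sqfree, degree_sqfree, Finset.card_map, Finset.card_map]
  have h1 : U.card ≤ n / 2 := (Finset.card_le_univ U).trans (by rw [Fintype.card_fin])
  have h2 : U'.card ≤ n / 2 := (Finset.card_le_univ U').trans (by rw [Fintype.card_fin])
  omega

variable (n) in
/-- The coefficient coordinate `c_{x^{ρ_A U} x^{κ_A U'}}` of the cut `A`. [folklore] -/
def cutCoord (A : Cut n) (U U' : HSub n) : degLEMonomials n :=
  ⟨sqfree (U'.map (colEmb A)) + sqfree (U.map (rowEmb A)), degree_cutExp_le A U U'⟩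

variable (n) in
/-- **Nisan's coefficient matrix of VARIABLES across the cut `A`**: rows `U` (square-free monomials
in the cut variables `ρ_A U`), columns `U'` (square-free monomials in the complementary variables
`κ_A U'`), entry `c_{x^{ρ_A U} x^{κ_A U'}}`. [cite: Nisan1991Noncommutative, Lemma 1] -/
def cutMatrix (A : Cut n) : Matrix (HSub n) (HSub n) (MvPolynomial (degLEMonomials n) ℂ) :=
  Matrix.of fun U U' => X (cutCoord n A U U')

variable (n) in
/-- **The certificate against ROABPs of every order**: the product over all balanced cuts of the
determinants of Nisan's coefficient matrices. [cite: Nisan1991Noncommutative, Thm 1] -/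
def nisanCert : MvPolynomial (degLEMonomials n) ℂ := ∏ A : Cut n, (cutMatrix n A).det

/-- Evaluating one factor at a point of coefficient space. [folklore] -/
theorem eval_det_cutMatrix (g : degLEMonomials n → ℂ) (A : Cut n) :
    eval g (cutMatrix n A).det = (Matrix.of fun U U' => g (cutCoord n A U U')).det := by
  rw [RingHom.map_det]
  congr 1
  ext U U'
  simp [cutMatrix]

/-- Evaluating the certificate: the product of the evaluated factors. [folklore] -/
theorem eval_nisanCert (g : degLEMonomials n → ℂ) :
    eval g (nisanCert n) = ∏ A : Cut n, (Matrix.of fun U U' => g (cutCoord n A U U')).det := by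
  rw [nisanCert, map_prod]
  exact Finset.prod_congr rfl fun A _ => eval_det_cutMatrix g A

/-! ## Nisan's rank bound for an ROABP across the cut of its own order -/

/-- `2⌊n/2⌋ ≤ n`. [folklore] -/
theorem half_le (n : ℕ) : n / 2 ≤ n := Nat.div_le_self n 2

/-- The cut of an order `π`: the first `⌊n/2⌋` variables read. [folklore] -/
def orderCut (π : Fin n ≃ Fin n) : Cut n :=
  ⟨(Finset.univ : Finset (Fin (n / 2))).map
      ⟨fun j => π (Fin.castLE (half_le n) j), fun j j' h => by
        have := Fin.castLE_injective (half_le n) (π.injective h); exact this⟩,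
    by rw [Finset.card_map, Finset.card_univ, Fintype.card_fin]⟩

/-- Membership in the cut of an order: `π i ∈ A_π ↔ i < ⌊n/2⌋`. [folklore] -/
theorem apply_mem_orderCut_iff (π : Fin n ≃ Fin n) (i : Fin n) :
    π i ∈ (orderCut π).1 ↔ (i : ℕ) < n / 2 := by
  constructor
  · intro h
    obtain ⟨j, -, hj⟩ := Finset.mem_map.mp h
    have hij : Fin.castLE (half_le n) j = i := π.injective hj
    rw [← hij]
    exact j.2
  · intro h
    exact Finset.mem_map.mpr ⟨⟨i, h⟩, Finset.mem_univ _, by simp⟩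

/-- **Nisan's rank bound, row form.**  If `f` is computed by a width-`w` ROABP in the order `π`,
then every row of the coefficient matrix of `f` across the cut `A_π` lies in the span of `w` fixed
vectors: `f = Σ_{r<w} P_{0r} Q_{r0}` with `P` in the cut variables and `Q` in the others, and
`coeff_{x^{ρU} x^{κU'}} f = Σ_r coeff_{x^{ρU}} P_{0r} · coeff_{x^{κU'}} Q_{r0}`.
[cite: Nisan1991Noncommutative, Lemma 1 and Thm 1] -/
theorem row_mem_span_of_isROABP {w d : ℕ} {π : Fin n ≃ Fin n} {f : MvPolynomial (Fin n) ℂ}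
    (hf : IsROABP ℂ w d π f) :
    ∃ v : Fin w → (HSub n → ℂ), ∀ U : HSub n,
      (Matrix.of fun U U' => coeffVector (degLEMonomials n) f (cutCoord n (orderCut π) U U')) U ∈
        Submodule.span ℂ (Set.range v) := by
  classical
  obtain ⟨hw, M, hM, rfl⟩ := hf
  set A : Cut n := orderCut π with hAdef
  -- split the ordered product after the first `⌊n/2⌋` layers
  set t := n / 2 with ht
  obtain ⟨u, hu⟩ : ∃ u, n = t + u := ⟨n - t, by have := half_le n; omega⟩
  let M₁ : Fin t → Matrix (Fin w) (Fin w) (MvPolynomial (Fin n) ℂ) :=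
    fun i => M (Fin.cast hu.symm (Fin.castLE (Nat.le_add_right t u) i))
  let M₂ : Fin u → Matrix (Fin w) (Fin w) (MvPolynomial (Fin n) ℂ) :=
    fun j => M (Fin.cast hu.symm (Fin.natAdd t j))
  have hsplit : (List.ofFn M).prod = (List.ofFn M₁).prod * (List.ofFn M₂).prod := by
    rw [List.ofFn_congr hu M, List.ofFn_add, List.prod_append]
  -- supports of the two halves
  have hP : ∀ a b, (List.ofFn M₁).prod a b ∈ supported ℂ (↑A.1 : Set (Fin n)) := by
    refine apply_prod_mem _ _ fun X hX a b => ?_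
    obtain ⟨i, rfl⟩ := (List.mem_ofFn' _ _).mp hX
    obtain ⟨p, -, hp⟩ := hM (Fin.cast hu.symm (Fin.castLE (Nat.le_add_right t u) i)) a b
    show M (Fin.cast hu.symm (Fin.castLE (Nat.le_add_right t u) i)) a b ∈ _
    rw [hp]
    refine aeval_X_mem_supported ?_ p
    rw [Finset.mem_coe, hAdef, apply_mem_orderCut_iff]
    have hi := i.2
    simp only [Fin.val_cast, Fin.val_castLE]
    omega
  have hQ : ∀ a b, (List.ofFn M₂).prod a b ∈ supported ℂ (↑A.1 : Set (Fin n))ᶜ := by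
    refine apply_prod_mem _ _ fun X hX a b => ?_
    obtain ⟨j, rfl⟩ := (List.mem_ofFn' _ _).mp hX
    obtain ⟨p, -, hp⟩ := hM (Fin.cast hu.symm (Fin.natAdd t j)) a b
    show M (Fin.cast hu.symm (Fin.natAdd t j)) a b ∈ _
    rw [hp]
    refine aeval_X_mem_supported ?_ p
    rw [Set.mem_compl_iff, Finset.mem_coe, hAdef, apply_mem_orderCut_iff]
    simp only [Fin.val_cast, Fin.val_natAdd]
    omega
  -- the `w` spanning vectors: the column-coefficient vectors of the `Q_{r0}`
  refine ⟨fun r U' => coeff (sqfree (U'.map (colEmb A))) ((List.ofFn M₂).prod r ⟨0, hw⟩), fun U => ?_⟩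
  have hrow : (Matrix.of fun U U' => coeffVector (degLEMonomials n) ((List.ofFn M).prod ⟨0, hw⟩ ⟨0, hw⟩)
      (cutCoord n (orderCut π) U U')) U =
      ∑ r : Fin w, coeff (sqfree (U.map (rowEmb A))) ((List.ofFn M₁).prod ⟨0, hw⟩ r) •
        fun U' => coeff (sqfree (U'.map (colEmb A))) ((List.ofFn M₂).prod r ⟨0, hw⟩) := by
    funext U'
    rw [Matrix.of_apply, coeffVector_apply, Finset.sum_apply]
    show coeff (sqfree (U'.map (colEmb A)) + sqfree (U.map (rowEmb A)))
      ((List.ofFn M).prod ⟨0, hw⟩ ⟨0, hw⟩) = _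
    rw [hsplit, Matrix.mul_apply, coeff_sum]
    refine Finset.sum_congr rfl fun r _ => ?_
    rw [Pi.smul_apply, smul_eq_mul, add_comm,
      coeff_add_mul_of_supported (hP _ _) (hQ _ _) (support_sqfree_map_rowEmb A U)
        (support_sqfree_map_colEmb A U')]
  rw [hrow]
  exact Submodule.sum_mem _ fun r _ => Submodule.smul_mem _ _ (Submodule.subset_span ⟨r, rfl⟩)

/-- **The factor of the cut `A_π` vanishes on ROABPs of order `π` and width `w < 2^{⌊n/2⌋}`.**
[cite: Nisan1991Noncommutative, Thm 1] -/
theorem det_cutMatrix_orderCut_eq_zero {w d : ℕ} {π : Fin n ≃ Fin n} {f : MvPolynomial (Fin n) ℂ}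
    (hf : IsROABP ℂ w d π f) (hw : w < 2 ^ (n / 2)) :
    (Matrix.of fun U U' => coeffVector (degLEMonomials n) f (cutCoord n (orderCut π) U U')).det = 0 := by
  classical
  obtain ⟨v, hv⟩ := row_mem_span_of_isROABP hf
  refine det_eq_zero_of_rows_mem_submodule _ (Submodule.span ℂ (Set.range v)) ?_ hv
  calc Module.finrank ℂ (Submodule.span ℂ (Set.range v)) ≤ Fintype.card (Fin w) :=
        finrank_range_le_card v
    _ = w := Fintype.card_fin w
    _ < 2 ^ (n / 2) := hw
    _ = Fintype.card (HSub n) := by rw [Fintype.card_finset, Fintype.card_fin]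

/-- **The certificate vanishes on every ROABP of width `w < 2^{⌊n/2⌋}`, in every order.**
[cite: Nisan1991Noncommutative, Thm 1] -/
theorem eval_nisanCert_eq_zero_of_isROABP {w d : ℕ} {π : Fin n ≃ Fin n}
    {f : MvPolynomial (Fin n) ℂ} (hf : IsROABP ℂ w d π f) (hw : w < 2 ^ (n / 2)) :
    eval (coeffVector (degLEMonomials n) f) (nisanCert n) = 0 := by
  rw [eval_nisanCert]
  exact Finset.prod_eq_zero (Finset.mem_univ (orderCut π)) (det_cutMatrix_orderCut_eq_zero hf hw)

/-- Slice form of the vanishing. [cite: Nisan1991Noncommutative, Thm 1] -/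
theorem eval_nisanCert_eq_zero_of_mem {w : ℕ} (hw : w < 2 ^ (n / 2)) {f : MvPolynomial (Fin n) ℂ}
    (hf : f ∈ roabpSlice n w) : eval (coeffVector (degLEMonomials n) f) (nisanCert n) = 0 := by
  obtain ⟨-, π, hπ⟩ := hf
  exact eval_nisanCert_eq_zero_of_isROABP hπ hw

end slice

end Summit.ValiantsHypothesis.ValiantsHypothesis.Theorems.BarrierLever.ROABPSlice

end
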